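/-
HONEST FRAMING: certified error envelopes and provably optimal rounding/accumulation schemes for
low-precision formats under stated cost models; every table by two implementations; no hardware
or vendor claims.
-/
import Mathlib.Tactic.IntervalCases
import Summits.Ventures.CertifiedArithmetic.LowPrec.OptDemotionRoutingConeQ2
import Summits.Ventures.CertifiedArithmetic.LowPrec.OptDemotionRoutingConeQ3
import Summits.Ventures.CertifiedArithmetic.LowPrec.OptDemotionRoutingConeR4

/-!
# The demotion law (Theorem T8), part 9h: CONJECTURE D FOR EVERY TREE AT EVERY PRECISION 2 ≤ q ≤ 5

One citable statement assembling the four kernel-checked cone-closure certificates (parts 9f: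
`TT_two`, `TT_three`, `TT_four`, `TT_five`): opt's two-tree inequality, the routing conjecture
`W = BR` for every shape, and CONJECTURE D `s ≤ Q_t · fl_p(ŝ)` for every summation tree, at every
precision `q` with `2 ≤ q ≤ 5` (every `p ≥ 1`, any nearest roundings, nonnegative data), with the
R4 record.  (`TT 1` is vacuous and part 8n needs `q ≥ 2`; `q ≥ 6` is open: opt's closure at `q = 6`
is partial, C38/C39.)
-/

namespace Summit.Ventures.CertifiedArithmetic.LowPrec.Opt

open Literature.ComputerArithmetic.JeannerodRump2018
open Literature.ComputerArithmetic.JeannerodRump2018.SumTree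
open Cone

/-- **opt's TWO-TREE INEQUALITY `TT q` FOR EVERY `2 ≤ q ≤ 5`.** -/
theorem TT_of_le_five {q : ℕ} (h2 : 2 ≤ q) (h5 : q ≤ 5) : TT q := by
  interval_cases q
  · exact TT_two
  · exact TT_three
  · exact TT_four
  · exact TT_five

/-- **THE ROUTING CONJECTURE `W = BR` FOR EVERY SHAPE AT EVERY `2 ≤ q ≤ 5`.** -/
theorem routingBound_of_le_five {q : ℕ} (h2 : 2 ≤ q) (h5 : q ≤ 5) (s : Shape) : RoutingBound q s :=
  routingBound_of_TT h2 (TT_of_le_five h2 h5) s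

/-- **CONJECTURE D FOR EVERY SUMMATION TREE AT EVERY PRECISION `2 ≤ q ≤ 5`** (OPTIMA T8(b)(iii)):
for every `p ≥ 1`, any nearest roundings `fl` into `F(q, emin)` and `flp` into `F(p, emin)`, and
every summation tree `t` of nonnegative `F(q, emin)` data, `s ≤ Q_t(u_q, u_p) · fl_p(ŝ)`. -/
theorem conjectureD_of_le_five {q p : ℕ} (h2 : 2 ≤ q) (h5 : q ≤ 5) (hp : 1 ≤ p) {emin : ℤ}
    {fl flp : ℚ → ℚ} (hfl : IsRoundNearest q emin fl) (hflp : IsRoundNearest p emin flp)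
    (t : SumTree) (ht : ∀ x ∈ leaves t, IsFloat q emin x ∧ 0 ≤ x) :
    exact t ≤ treeQf (unitRoundoff q) t (unitRoundoff p) * flp (eval fl t) :=
  conjectureD_of_TT hp h2 (TT_of_le_five h2 h5) hfl hflp t ht

/-- R4 (Opt, CM-B demote, OPTIMA T8(b)(iii)) CONJECTURE D FOR EVERY SUMMATION TREE AT EVERY
PRECISION `2 ≤ q ≤ 5`, every `p ≥ 1`, any nearest roundings, nonnegative data. -/
def R4_DemotionLawEveryTreeLeFive : Prop :=
  ∀ (q p : ℕ) (emin : ℤ) (fl flp : ℚ → ℚ), 2 ≤ q → q ≤ 5 → 1 ≤ p → IsRoundNearest q emin fl →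
    IsRoundNearest p emin flp → ∀ t : SumTree, (∀ x ∈ leaves t, IsFloat q emin x ∧ 0 ≤ x) →
      exact t ≤ treeQf (unitRoundoff q) t (unitRoundoff p) * flp (eval fl t)

/-- Discharge of `R4_DemotionLawEveryTreeLeFive` by `conjectureD_of_le_five`. -/
theorem R4_DemotionLawEveryTreeLeFive_holds : R4_DemotionLawEveryTreeLeFive :=
  fun _ _ _ _ _ h2 h5 hp hfl hflp t ht => conjectureD_of_le_five h2 h5 hp hfl hflp t ht

end Summit.Ventures.CertifiedArithmetic.LowPrec.Opt
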